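import Summits.AnomalousDissipation.AnomalousDissipation.Theorems.SawtoothPulseCascadeK1LocalisedCascadeIterateGradient
import Summits.AnomalousDissipation.AnomalousDissipation.Theorems.SawtoothPulseCascadeK1LocalisedCascadeLedgerK1Localised

/-!
# K1loc, line `Spectral` / SeqCone — helper: `K1Localised` FROM A UNIFORM BOUND ON THE INVISCID ITERATES (S-B ∘ S-D transfer)

Helper file of the prover lane on the crux `K1LocalisedCascade` (stmt-AnomalousDissipation-19491), route
`SawtoothPulseCascade` (S-B/S-C assembly seat).  Composition of `…K1Ledger.k1Localised_of_uniform_firstGoodPiece` (the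
whole S-B ledger: `K1Localised P (γ²−3)` from a uniform first good piece in LIMIT form) with k1loc-p1's `κ → 0` start
transfer `…K1Start.sqrt_tsum_symbol_sq_datum_le_of_inviscid` (the limit-form socket from ONE bound on ONE explicit inviscid
iterate, `κ₁` free): **`k1Localised_of_uniform_iterate_bound`** — for the cascade at the crux point with symbolic `δ₀`
(`N₀ = 1`, `ρN = 2`, `d = 2`, `5 ≤ γ ≤ 8`, `0 < δ₀ ≤ 1/4`, schedule radius `L₀ ≥ 1000`), if the INVISCID ITERATES
`a_n` of the datum (`a 0 = datum`, `b j = a j ∘ Φ_{H,j}⁻¹`, `a (j+1) = b j ∘ Φ_{V,j}⁻¹`) have tracked start energy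
`√(Σ μᴴ_n(k)²|𝓕a_n(k)|²) ≤ q` for ONE level `q < ‖datum‖` and ALL `n ≥ i₁`, then `K1Localised P (γ² − 3)`.
The remaining hypothesis is PDE-free: a statement about explicit compositions of `sin 2πx₁` with `2n` inverse pulse maps
(S-D; memo v8).  No definitions; no statement about the crux at `δ₀ = ¼`.
[cite: DEIJ2022, (1.2)–(1.3)] [cite: BedrossianCotiZelati2017, §2] [problem: turb]
-/

-- `Summit.<Summit>.<Problem>`: single-conjunct summit, the duplicate namespace segment is deliberate.
set_option linter.dupNamespace false

noncomputable section

namespace Summit.AnomalousDissipation.AnomalousDissipation.Theorems.SawtoothPulseCascade.K1Ledger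

open MeasureTheory Set Filter Topology UnitAddTorus Function
open Literature.Analysis Literature.Analysis.FunctionSpaces Literature.Analysis.FunctionSpaces.Torus Literature.Analysis.FluidPDE
open Literature.Analysis.FluidPDE.ShearStage
open Literature.Analysis.FluidPDE.SawtoothCascade Literature.Analysis.FluidPDE.SawtoothCascade.CascadeParams
open Summit.AnomalousDissipation.AnomalousDissipation.Theorems.SawtoothPulseCascade.K1Start

/-- `A·√(2κ₁TE) ≤ η²` for the threshold `κ₁ = η⁴/(A²(2TE) + 1)` (`A, T, E ≥ 0`). [folklore] -/
theorem mul_sqrt_threshold_le {A T E η : ℝ} (hA : 0 ≤ A) (hT : 0 ≤ T) (hE : 0 ≤ E) :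
    A * Real.sqrt (2 * (η ^ 4 / (A ^ 2 * (2 * T * E) + 1)) * T * E) ≤ η ^ 2 := by
  have hS : 0 ≤ A ^ 2 * (2 * T * E) := by positivity
  have h1 : A * Real.sqrt (2 * (η ^ 4 / (A ^ 2 * (2 * T * E) + 1)) * T * E) =
      Real.sqrt (A ^ 2 * (2 * T * E) / (A ^ 2 * (2 * T * E) + 1) * η ^ 4) := by
    rw [← Real.sqrt_sq hA, ← Real.sqrt_mul (sq_nonneg A), Real.sqrt_sq hA]
    congr 1
    field_simp
  rw [h1]
  refine Real.sqrt_le_iff.2 ⟨sq_nonneg η, ?_⟩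
  have hfrac : A ^ 2 * (2 * T * E) / (A ^ 2 * (2 * T * E) + 1) ≤ 1 := by
    rw [div_le_one (by positivity)]; linarith
  calc A ^ 2 * (2 * T * E) / (A ^ 2 * (2 * T * E) + 1) * η ^ 4 ≤ 1 * η ^ 4 :=
        mul_le_mul_of_nonneg_right hfrac (by positivity)
    _ = (η ^ 2) ^ 2 := by ring

section Cascade

variable (P : CascadeParams)

/-- **`K1Localised P (γ² − 3)` from a UNIFORM bound on the inviscid iterates of the datum.**  See the module docstring.
[cite: DEIJ2022, (1.2)–(1.3)] [cite: BedrossianCotiZelati2017, §2] -/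
theorem k1Localised_of_uniform_iterate_bound (hγ : 5 ≤ P.γ) (hγ' : P.γ ≤ 8) (hδ₀ : 0 < P.δ₀) (hδ₀' : P.δ₀ ≤ 1 / 4)
    (hd : P.d = 2) (hN₀ : P.N₀ = 1) (hρN : P.ρN = 2) {L₀ : ℝ} (hL₀ : 1000 ≤ L₀) (hE : 0 < Torus.scalarL2Sq datum)
    (a b : ℕ → UnitAddTorus (Fin 2) → ℝ) (has : ∀ j, IsSmooth (a j)) (h0 : a 0 = datum)
    (hb : ∀ j, b j = a j ∘ shearMap 0 1 (amp ⟨P.U j, P.U_periodic j, P.contDiff_U (P.δ_pos hδ₀ (by rw [hd]; norm_num) j)⟩ P.γ))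
    (hab : ∀ j, a (j + 1) = b j ∘ shearMap 1 0 (amp ⟨P.U j, P.U_periodic j, P.contDiff_U (P.δ_pos hδ₀ (by rw [hd]; norm_num) j)⟩ P.γ))
    {q : ℝ} (hq : 0 ≤ q) (hqE : q < Real.sqrt (Torus.scalarL2Sq datum)) {i₁ : ℕ}
    (hiter : ∀ n : ℕ, i₁ ≤ n →
      Real.sqrt (∑' k : Fin 2 → ℤ, (1 - Real.smoothTransition ((|((k 0 : ℤ) : ℝ)| - L₀ * ((P.γ ^ 2 - 5 / 2) / (1 + 1 / 250) ^ 2 - 1 / (2 * (1 + 1 / 250) * L₀)) ^ n) /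
            (1 / 250 * (L₀ * ((P.γ ^ 2 - 5 / 2) / (1 + 1 / 250) ^ 2 - 1 / (2 * (1 + 1 / 250) * L₀)) ^ n))) *
          (1 - Real.smoothTransition ((P.γ * |((k 1 : ℤ) : ℝ)| - 13 / 10 * |((k 0 : ℤ) : ℝ)|) /
            (1 / 20 * (L₀ * ((P.γ ^ 2 - 5 / 2) / (1 + 1 / 250) ^ 2 - 1 / (2 * (1 + 1 / 250) * L₀)) ^ n)))) *
        ((1 - Real.smoothTransition ((|((k 0 : ℤ) : ℝ)| - 2 * L₀ * ((1 + P.γ) ^ 2 + 1) ^ n) /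
            (L₀ * ((P.γ ^ 2 - 5 / 2) / (1 + 1 / 250) ^ 2 - 1 / (2 * (1 + 1 / 250) * L₀)) ^ n / (20 * P.γ * (1 + 1 / 250))))) *
          (1 - Real.smoothTransition ((|((k 1 : ℤ) : ℝ)| - 2 * L₀ * ((1 + P.γ) ^ 2 + 1) ^ n) /
            (L₀ * ((P.γ ^ 2 - 5 / 2) / (1 + 1 / 250) ^ 2 - 1 / (2 * (1 + 1 / 250) * L₀)) ^ n / (20 * P.γ * (1 + 1 / 250))))))) ^ 2 * ‖mFourierCoeff (fun x => (a n x : ℂ)) k‖ ^ 2) ≤ q) :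
    K1Localised P (P.γ ^ 2 - 3) := by
  have hγ0 : 0 ≤ P.γ := by linarith
  have hd0 : 0 < P.d := by rw [hd]; norm_num
  have hE0 : 0 ≤ Torus.scalarL2Sq datum := hE.le
  refine k1Localised_of_uniform_firstGoodPiece P hγ hγ' hδ₀ hδ₀' hd hN₀ hρN hL₀ hE hq hqE (i₁ := i₁) ?_
  intro i₀ hi η hη
  -- the enstrophy constant of the first `i₀` phases and the threshold `κ₁(η)`
  set A : ℝ := 2 * Real.pi * Real.sqrt (1 + (1 + P.γ) ^ 2) * (1 + P.γ) ^ (2 * i₀) with hA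
  have hA0 : 0 ≤ A := by positivity
  have hT0 : 0 ≤ tStart i₀ := tStart_nonneg i₀
  set κ₁ : ℝ := η ^ 4 / (A ^ 2 * (2 * tStart i₀ * Torus.scalarL2Sq datum) + 1) with hκ₁
  have hκ₁0 : 0 < κ₁ := by positivity
  refine ⟨κ₁, hκ₁0, fun κ hκ w hw hw0 => ?_⟩
  have h := sqrt_tsum_symbol_sq_datum_le_of_inviscid P hγ0 hδ₀ hd0 a b has h0 hb hab i₀ _
    (fun k => abs_muH_le_one P.γ L₀ i₀ k) (κ₁ := κ₁) (hiter i₀ hi) κ hκ w hw hw0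
  refine h.trans (add_le_add le_rfl ?_)
  refine Real.sqrt_le_iff.2 ⟨hη.le, ?_⟩
  exact mul_sqrt_threshold_le (η := η) hA0 hT0 hE0

end Cascade

end Summit.AnomalousDissipation.AnomalousDissipation.Theorems.SawtoothPulseCascade.K1Ledger
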